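import Literature.Analysis.FluidPDE.TypeIAncientMild
import Literature.Analysis.FluidPDE.BoundedWeakIsometry
import Literature.Analysis.FluidPDE.SelfSimilarProofs
import Literature.Analysis.FluidPDE.KatoViscosityScaling
import Literature.Analysis.FluidPDE.HeatExtensionVanishingAtInfinity
import Literature.Analysis.FunctionSpaces.SupNormSubmoduleOperators
import HarnessLib

/-!
# The Banach space `C₀,σ` of continuous weakly divergence-free fields vanishing at infinity

Analysis/FluidPDE support file (everything proved; no definitions, no named facts).  On a
finite-dimensional real inner product space `E`, the class
`𝒢 = {g : E → E continuous, g → 0 at infinity, ∫⟪g, ∇θ⟫ = 0 for all test θ}` is realised as a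
**closed submodule of `ℓ^∞(E; E)`** (Mathlib's `lp (fun _ : E => E) ⊤`, sup norm), hence as a
Banach space with inherited instances (`exists_isClosed_submodule_czero_solenoidal`): the class
is stable under sums and scalars, and under uniform limits (uniform limits of continuous
functions are continuous, of `C₀` functions are `C₀`, and the constraint `∫⟪g, ∇θ⟫ = 0` passes
to the limit by dominated convergence).  Two basic operators of the class are provided as
bounded operators of the space through the pointwise lifting of
`Literature.Analysis.FunctionSpaces.exists_clm_of_pointwise`:

* the **rotated zoom-out** `g ↦ a R g(a R⁻¹ ·)` (`a > 0`, `R` a linear isometry), of norm `≤ a`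
  (`exists_zoom_clm`; for a rotated discretely self-similar profile with factor `c` this is the
  map `𝒮⁻¹` with `a = c⁻¹ < 1`, Chae–Wolf 2017, Def. 1.1; Bradshaw–Tsai 2017, §1);
* the **heat semigroup** `g ↦ e^{τΔ}g` (`τ > 0`), a contraction (`exists_heat_clm`; maximum
  principle, weak divergence-freeness through the caloric pairing, and the `C₀` property of
  `tendsto_heatExtension_cocompact`).

## Mathlib / tree search

Tree: `IsWeaklyDivFree`, `IsWeaklyDivFree.const_smul`, `IsWeaklyDivFree.conj_linearIsometryEquiv`,
`IsWeaklyDivFree.nsRescaleData`, `IsWeaklyDivFree.heatExtension_of_bound`,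
`UnboundedOperators.norm_heatExtension_le`, `contDiff_heatExtension_of_bound`,
`heatExtension_add_of_bound`, `heatExtension_const_smul`, `tendsto_heatExtension_cocompact`,
`integrable_inner_of_continuous_of_hasCompactSupport`, `exists_clm_of_pointwise`.
Mathlib: `lp`, `isSeqClosed_iff_isClosed`, `TendstoUniformly.continuous`,
`tendsto_integral_filter_of_dominated_convergence`.

## References

* D. Chae, J. Wolf, *Existence of discretely self-similar solutions to the Navier–Stokes
  equations for initial value in `L²_loc(ℝ³)`*, 2017, Def. 1.1. [ChaeWolf2017]
* K.-J. Engel, R. Nagel, *One-Parameter Semigroups for Linear Evolution Equations*, Springer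
  2000, Ch. II, 2.13. [folklore]
-/

noncomputable section

open MeasureTheory Set Function Filter Metric
open _root_.Topology
open scoped RealInnerProductSpace

namespace Literature.Analysis.FluidPDE

variable {E : Type*} [NormedAddCommGroup E] [InnerProductSpace ℝ E] [FiniteDimensional ℝ E]
  [MeasurableSpace E] [BorelSpace E]

/-! ### Algebra of the class -/

/-- The sum of two continuous weakly divergence-free fields is weakly divergence free (both
pairings with `∇θ` are integrable). [folklore] -/
theorem IsWeaklyDivFree.add_of_continuous {v w : E → E} (hv : IsWeaklyDivFree v)
    (hw : IsWeaklyDivFree w) (hvc : Continuous v) (hwc : Continuous w) :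
    IsWeaklyDivFree (v + w) := by
  haveI : CompleteSpace E := FiniteDimensional.complete ℝ E
  intro θ hθ
  have hgc : Continuous (gradient θ) :=
    (InnerProductSpace.toDual ℝ E).symm.continuous.comp (hθ.contDiff.continuous_fderiv (by simp))
  have hgs : HasCompactSupport (gradient θ) :=
    (hθ.hasCompactSupport.fderiv (𝕜 := ℝ)).comp_left (g := (InnerProductSpace.toDual ℝ E).symm)
      (map_zero _)
  have iv := integrable_inner_of_continuous_of_hasCompactSupport hvc hgc hgs
  have iw := integrable_inner_of_continuous_of_hasCompactSupport hwc hgc hgs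
  simp only [Pi.add_apply, inner_add_left]
  rw [integral_add iv iw, hv θ hθ, hw θ hθ, add_zero]

/-- The zero field is weakly divergence free. [folklore] -/
theorem isWeaklyDivFree_zero_pi : IsWeaklyDivFree (0 : E → E) := by
  intro θ _
  simp

/-! ### The closed submodule -/

/-- **`C₀,σ` as a closed submodule of `ℓ^∞(E; E)`.** There is a closed submodule `F` of
`lp (fun _ : E => E) ⊤` whose elements are exactly the bounded fields which are continuous,
tend to `0` at infinity and are weakly divergence free.  Closedness: a limit in sup norm is a
uniform limit, hence continuous and `C₀`, and `∫⟪fₙ, ∇θ⟫ = 0` passes to the limit by dominated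
convergence (`‖fₙ‖_∞` is eventually bounded and `∇θ` is continuous with compact support). In
particular `↥F` is a Banach space (`IsClosed.completeSpace_coe`). [folklore] -/
theorem exists_isClosed_submodule_czero_solenoidal :
    ∃ F : Submodule ℝ (lp (fun _ : E => E) ⊤), IsClosed (F : Set (lp (fun _ : E => E) ⊤)) ∧
      ∀ f : lp (fun _ : E => E) ⊤, f ∈ F ↔
        (Continuous ⇑f ∧ Tendsto ⇑f (cocompact E) (𝓝 0) ∧ IsWeaklyDivFree ⇑f) := by
  haveI : CompleteSpace E := FiniteDimensional.complete ℝ E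
  let F : Submodule ℝ (lp (fun _ : E => E) ⊤) :=
    { carrier := {f | Continuous ⇑f ∧ Tendsto ⇑f (cocompact E) (𝓝 0) ∧ IsWeaklyDivFree ⇑f}
      add_mem' := by
        rintro f g ⟨hfc, hf0, hfd⟩ ⟨hgc, hg0, hgd⟩
        refine ⟨?_, ?_, ?_⟩
        · rw [lp.coeFn_add]; exact hfc.add hgc
        · rw [lp.coeFn_add]
          have h := hf0.add hg0
          rw [add_zero] at h
          exact h
        · rw [lp.coeFn_add]; exact hfd.add_of_continuous hgd hfc hgc
      zero_mem' := by
        refine ⟨?_, ?_, ?_⟩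
        · rw [lp.coeFn_zero]; exact continuous_const
        · rw [lp.coeFn_zero]; exact tendsto_const_nhds
        · rw [lp.coeFn_zero]; exact isWeaklyDivFree_zero_pi
      smul_mem' := by
        rintro r f ⟨hfc, hf0, hfd⟩
        refine ⟨?_, ?_, ?_⟩
        · rw [lp.coeFn_smul]; exact hfc.const_smul r
        · rw [lp.coeFn_smul]
          have h := hf0.const_smul r
          rw [smul_zero] at h
          exact h
        · rw [lp.coeFn_smul]; exact hfd.const_smul r }
  refine ⟨F, ?_, fun f => Iff.rfl⟩
  rw [← isSeqClosed_iff_isClosed]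
  intro u p hu hlim
  have hu' : ∀ n, Continuous ⇑(u n) ∧ Tendsto ⇑(u n) (cocompact E) (𝓝 0) ∧
      IsWeaklyDivFree ⇑(u n) := hu
  have hnorm : Tendsto (fun n => ‖u n - p‖) atTop (𝓝 0) :=
    tendsto_iff_norm_sub_tendsto_zero.1 hlim
  have hpt : ∀ n x, ‖(u n) x - p x‖ ≤ ‖u n - p‖ := fun n x => by
    have h := lp.norm_apply_le_norm ENNReal.top_ne_zero (u n - p) x
    simpa [lp.coeFn_sub] using h
  have hunif : TendstoUniformly (fun n => ⇑(u n)) ⇑p atTop := by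
    refine Metric.tendstoUniformly_iff.2 fun ε hε => ?_
    filter_upwards [(tendsto_order.1 hnorm).2 ε hε] with n hn x
    rw [dist_comm, dist_eq_norm]
    exact (hpt n x).trans_lt hn
  have hpc : Continuous ⇑p := hunif.continuous (Eventually.of_forall fun n => (hu' n).1).frequently
  refine ⟨hpc, ?_, ?_⟩
  · -- vanishing at infinity
    rw [tendsto_cocompact_nhds_zero_iff_norm]
    intro ε hε
    obtain ⟨N, hN⟩ := Metric.tendsto_atTop.1 hnorm (ε / 2) (half_pos hε)
    have hN' : ‖u N - p‖ < ε / 2 := by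
      have h := hN N le_rfl
      rwa [Real.dist_eq, sub_zero, abs_of_nonneg (norm_nonneg _)] at h
    obtain ⟨A, hA⟩ := tendsto_cocompact_nhds_zero_iff_norm.1 (hu' N).2.1 (ε / 2) (half_pos hε)
    refine ⟨A, fun x hx => ?_⟩
    calc ‖p x‖ = ‖(u N) x - ((u N) x - p x)‖ := by rw [sub_sub_cancel]
      _ ≤ ‖(u N) x‖ + ‖(u N) x - p x‖ := norm_sub_le _ _
      _ ≤ ε / 2 + ε / 2 := add_le_add (hA x hx) ((hpt N x).trans hN'.le)
      _ = ε := add_halves ε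
  · -- weak divergence-freeness passes to the uniform limit
    intro θ hθ
    have hgc : Continuous (gradient θ) :=
      (InnerProductSpace.toDual ℝ E).symm.continuous.comp (hθ.contDiff.continuous_fderiv (by simp))
    have hgs : HasCompactSupport (gradient θ) :=
      (hθ.hasCompactSupport.fderiv (𝕜 := ℝ)).comp_left (g := (InnerProductSpace.toDual ℝ E).symm)
        (map_zero _)
    obtain ⟨N, hN⟩ := Metric.tendsto_atTop.1 hnorm 1 one_pos
    have hbdN : ∀ n ≥ N, ∀ x, ‖(u n) x‖ ≤ ‖p‖ + 1 := by
      intro n hn x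
      have h1 : ‖u n - p‖ < 1 := by
        have h := hN n hn
        rwa [Real.dist_eq, sub_zero, abs_of_nonneg (norm_nonneg _)] at h
      have h2 : ‖(u n) x‖ ≤ ‖u n‖ := lp.norm_apply_le_norm ENNReal.top_ne_zero (u n) x
      have h3 : ‖u n‖ ≤ ‖p‖ + ‖u n - p‖ := by
        calc ‖u n‖ = ‖p + (u n - p)‖ := by rw [add_sub_cancel]
          _ ≤ ‖p‖ + ‖u n - p‖ := norm_add_le _ _
      linarith
    have hlimint : Tendsto (fun n => ∫ x, ⟪(u n) x, gradient θ x⟫) atTop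
        (𝓝 (∫ x, ⟪p x, gradient θ x⟫)) := by
      refine tendsto_integral_filter_of_dominated_convergence
        (fun x => (‖p‖ + 1) * ‖gradient θ x‖)
        (Eventually.of_forall fun n => ((hu' n).1.inner hgc).aestronglyMeasurable) ?_
        (((hgc.norm).integrable_of_hasCompactSupport hgs.norm).const_mul _) ?_
      · filter_upwards [eventually_ge_atTop N] with n hn
        refine Eventually.of_forall fun x => ?_
        calc ‖⟪(u n) x, gradient θ x⟫‖ ≤ ‖(u n) x‖ * ‖gradient θ x‖ := norm_inner_le_norm _ _
          _ ≤ (‖p‖ + 1) * ‖gradient θ x‖ :=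
            mul_le_mul_of_nonneg_right (hbdN n hn x) (norm_nonneg _)
      · exact Eventually.of_forall fun x => (hunif.tendsto_at x).inner tendsto_const_nhds
    have hzero : (fun n => ∫ x, ⟪(u n) x, gradient θ x⟫) = fun _ => (0 : ℝ) :=
      funext fun n => (hu' n).2.2 θ hθ
    rw [hzero] at hlimint
    exact (tendsto_nhds_unique tendsto_const_nhds hlimint).symm

/-! ### The zoom-out and the heat semigroup on the class -/

/-- **The rotated zoom-out preserves the class**: for `g` continuous, vanishing at infinity and
weakly divergence free, `a > 0` and a linear isometry `R`, the field `y ↦ a R g(a R⁻¹ y)` is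
again continuous, vanishing at infinity and weakly divergence free, with sup bound `a B` if
`‖g‖ ≤ B` (scale and isometry covariance of the weak divergence constraint). [cite: ChaeWolf2017, Def. 1.1] -/
theorem czero_solenoidal_zoom {g : E → E} (hgc : Continuous g)
    (hg0 : Tendsto g (cocompact E) (𝓝 0)) (hgd : IsWeaklyDivFree g) {a : ℝ} (ha : 0 < a)
    (R : E ≃ₗᵢ[ℝ] E) :
    Continuous (fun y => a • R (g (a • R.symm y))) ∧
      Tendsto (fun y => a • R (g (a • R.symm y))) (cocompact E) (𝓝 0) ∧
      IsWeaklyDivFree (fun y => a • R (g (a • R.symm y))) ∧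
      ∀ B : ℝ, (∀ x, ‖g x‖ ≤ B) → ∀ y, ‖a • R (g (a • R.symm y))‖ ≤ a * B := by
  refine ⟨?_, ?_, ?_, ?_⟩
  · exact (R.continuous.comp (hgc.comp (R.symm.continuous.const_smul a))).const_smul a
  · rw [tendsto_cocompact_nhds_zero_iff_norm] at hg0 ⊢
    intro ε hε
    obtain ⟨A, hA⟩ := hg0 (ε / a) (div_pos hε ha)
    refine ⟨A / a, fun y hy => ?_⟩
    have hy' : A ≤ ‖a • R.symm y‖ := by
      rw [norm_smul, Real.norm_of_nonneg ha.le, LinearIsometryEquiv.norm_map]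
      rwa [div_le_iff₀' ha] at hy
    calc ‖a • R (g (a • R.symm y))‖ = a * ‖g (a • R.symm y)‖ := by
          rw [norm_smul, Real.norm_of_nonneg ha.le, LinearIsometryEquiv.norm_map]
      _ ≤ a * (ε / a) := by gcongr; exact hA _ hy'
      _ = ε := mul_div_cancel₀ ε ha.ne'
  · have e : (fun y => a • R (g (a • R.symm y))) = nsRescaleData a (fun y => R (g (R.symm y))) := by
      funext y
      simp only [nsRescaleData_apply, LinearIsometryEquiv.map_smul]
    rw [e]
    exact IsWeaklyDivFree.nsRescaleData (hgd.conj_linearIsometryEquiv R) ha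
  · intro B hB y
    rw [norm_smul, Real.norm_of_nonneg ha.le, LinearIsometryEquiv.norm_map]
    exact mul_le_mul_of_nonneg_left (hB _) ha.le

/-- **The heat semigroup preserves the class**: for `g` continuous, vanishing at infinity,
weakly divergence free and bounded by `B`, and `τ > 0`, the caloric extension `e^{τΔ}g` is
continuous (indeed smooth), vanishes at infinity, is weakly divergence free, and is bounded by
`B` (maximum principle). [folklore] -/
theorem czero_solenoidal_heatExtension {g : E → E} (hgc : Continuous g)
    (hg0 : Tendsto g (cocompact E) (𝓝 0)) (hgd : IsWeaklyDivFree g) {B : ℝ} (hB : ∀ x, ‖g x‖ ≤ B)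
    {τ : ℝ} (hτ : 0 < τ) :
    Continuous (UnboundedOperators.heatExtension g τ) ∧
      Tendsto (UnboundedOperators.heatExtension g τ) (cocompact E) (𝓝 0) ∧
      IsWeaklyDivFree (UnboundedOperators.heatExtension g τ) ∧
      ∀ x, ‖UnboundedOperators.heatExtension g τ x‖ ≤ B := by
  haveI : CompleteSpace E := FiniteDimensional.complete ℝ E
  exact ⟨(UnboundedOperators.contDiff_heatExtension_of_bound hgc hB hτ (m := 0)).continuous,
    tendsto_heatExtension_cocompact hgc.aestronglyMeasurable hB hg0 hτ,
    hgd.heatExtension_of_bound hgc.aestronglyMeasurable hB hτ,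
    fun x => UnboundedOperators.norm_heatExtension_le hB hτ x⟩

/-- **The zoom-out as a bounded operator of norm `≤ a`** on the closed submodule `F ≅ C₀,σ`:
`(Z f)(y) = a R f(a R⁻¹ y)`. [cite: ChaeWolf2017, Def. 1.1] -/
theorem exists_zoom_clm (F : Submodule ℝ (lp (fun _ : E => E) ⊤))
    (hF : ∀ f : lp (fun _ : E => E) ⊤, f ∈ F ↔
      (Continuous ⇑f ∧ Tendsto ⇑f (cocompact E) (𝓝 0) ∧ IsWeaklyDivFree ⇑f))
    {a : ℝ} (ha : 0 < a) (R : E ≃ₗᵢ[ℝ] E) :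
    ∃ Z : F →L[ℝ] F, (∀ (f : F) (y : E), (Z f).1 y = a • R (f.1 (a • R.symm y))) ∧ ‖Z‖ ≤ a := by
  refine FunctionSpaces.exists_clm_of_pointwise F
    (P := fun g => Continuous g ∧ Tendsto g (cocompact E) (𝓝 0) ∧ IsWeaklyDivFree g) hF
    (fun g y => a • R (g (a • R.symm y))) ha.le ?_ ?_ ?_
  · intro g h _ _
    funext y
    simp only [Pi.add_apply, map_add, smul_add]
  · intro r g _
    funext y
    simp only [Pi.smul_apply, LinearIsometryEquiv.map_smul, smul_comm r a]
  · rintro g ⟨hgc, hg0, hgd⟩ B hB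
    obtain ⟨h1, h2, h3, h4⟩ := czero_solenoidal_zoom hgc hg0 hgd ha R
    exact ⟨⟨h1, h2, h3⟩, h4 B hB⟩

/-- **The heat semigroup as a contraction** of the closed submodule `F ≅ C₀,σ`:
`(H f)(x) = e^{τΔ}f(x)`, `‖H‖ ≤ 1` (`τ > 0`). [folklore] -/
theorem exists_heat_clm (F : Submodule ℝ (lp (fun _ : E => E) ⊤))
    (hF : ∀ f : lp (fun _ : E => E) ⊤, f ∈ F ↔
      (Continuous ⇑f ∧ Tendsto ⇑f (cocompact E) (𝓝 0) ∧ IsWeaklyDivFree ⇑f))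
    {τ : ℝ} (hτ : 0 < τ) :
    ∃ H : F →L[ℝ] F,
      (∀ (f : F) (x : E), (H f).1 x = UnboundedOperators.heatExtension (⇑f.1) τ x) ∧ ‖H‖ ≤ 1 := by
  refine FunctionSpaces.exists_clm_of_pointwise F
    (P := fun g => Continuous g ∧ Tendsto g (cocompact E) (𝓝 0) ∧ IsWeaklyDivFree g) hF
    (fun g => UnboundedOperators.heatExtension g τ) zero_le_one ?_ ?_ ?_
  · rintro g h ⟨hgc, hg0, -⟩ ⟨hhc, hh0, -⟩
    obtain ⟨Cg, -, hCg⟩ := exists_bound_of_tendsto_cocompact_nhds_zero hgc hg0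
    obtain ⟨Ch, -, hCh⟩ := exists_bound_of_tendsto_cocompact_nhds_zero hhc hh0
    funext x
    exact UnboundedOperators.heatExtension_add_of_bound hgc hhc hCg hCh hτ x
  · intro r g _
    funext x
    exact UnboundedOperators.heatExtension_const_smul r g τ x
  · rintro g ⟨hgc, hg0, hgd⟩ B hB
    obtain ⟨h1, h2, h3, h4⟩ := czero_solenoidal_heatExtension hgc hg0 hgd hB hτ
    exact ⟨⟨h1, h2, h3⟩, fun x => by rw [one_mul]; exact h4 x⟩

end Literature.Analysis.FluidPDE

end
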